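import Summits.ResolutionOfSingularities.ResolutionOfSingularities.Theorems.PurelyInseparableDim4ResConeKeepBudget
import HarnessLib
import HarnessLib.Audit.Tags

/-!
# Purely inseparable four-folds — TWO-SLOT GAME WITH ROTATING LETTERS: the implication form of the game, and a
# slot-constant tail is a FREE tail (cell `res-dim4-pi`, K2(p) lane, slice B brick K24a, R1 part γ₀′)

[OURS · counted 0 · cell `res-dim4-pi` · K2(p) lane (holder res-dim4-p-12 g3; K24a-R1 «rotation» = res-dim4-p-1, plan R1′ bus
2026-08-29 04:06Z / HOME `K24a-ROTATION-MEMO.md` §3); the game = res-dim4-idea-4 g3; seat res-dim4-p-1 g4.]  Nothing here proves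
K2(p)/K2(5), `NoIsolatedTrap p p` or resolution of singularities in dimension ≥ 4 / characteristic `p`.  AI kernel work, weaker
than expert review.

WHY.  With ROTATION steps (chart = the free letter, one slot letter translated away) the two SLOTS of idea-4's game are carried by
letters that change with time, and the readings of consecutive canonical frames agree only up to non-zero factors (unit-class
re-presentation, plan R1′).  So the landed game `…ResConeTwoSlotGame` (relabeling as EQUALITIES, fixed letters) and skeleton
`…ResConeTwoSlotSkeleton` (conclusion: constant chart) are re-dressed:

* §1 **`twoSlot_letterChange_freezes'`**, **`twoSlot_eventually_constant'`** — the same game with the three relabeling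
  hypotheses as IMPLICATIONS of non-vanishing (`s m 1 2 0 ≠ 0 → s (m+1) 1 2 0 ≠ 0` at a `λ`-step, etc.); same proof.
* §2 **`no_free_slot_tail`** — SLOT BOOKKEEPING ⇒ FREE TAIL: if after every slot-`A` step the slot is carried by the chart letter
  just used (`A (m+1) = j (k₁+m)`), and a slot-`A` step either charts the slot's letter or translates it away
  (`j (k₁+m) = A m ∨ b (k₁+m) (A m) ≠ 0` — cases S / F of idea-4's slot note), then a tail of slot-`A` steps has no satellite
  step, which the free-tail theorem (`FreeTailProof.noIsolatedFreeTailAt_self`) forbids on an isolated witnessed chain.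
* §3 **`no_twoSlot_tail_of_readings_free`** — γ₀′: readings satisfying §1's instances + §2's bookkeeping for both slots ⇒ `False`.

[cite: CossartJannsenSaito2020, Thm. 3.14, Thm. 9.3] [cite: Hauser2010, §§F–G] bears_on: LADDER-RESOLUTION:D157-DOOR2
(res-dim4-pi · K2(p) · slice B · K24a-R1 γ₀′).  Supports stmt-ResolutionOfSingularities-16155 (helper).
-/

set_option linter.dupNamespace false -- mandated namespace of this single-conjunct summit

namespace Summit.ResolutionOfSingularities.ResolutionOfSingularities.Theorems.PIDim4

namespace ResCone

open Literature.AlgebraicGeometry.Resolution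
open Literature.AlgebraicGeometry.Resolution.CentreBlowup

variable {K : Type} [Field K]

/-! ## 1. The game, implication form -/

/-- **THE LETTER CHANGE FREEZES THE SLOT** (implication form of `twoSlot_letterChange_freezes`): readings `s t`, `L m` =
«step `m` moves slot `λ`»; relabeling as implications of non-vanishing, legality and flag as before.  If step `k` is `λ`
and step `k + 1` is `μ`, then every step `m ≥ k + 2` is `λ` and `s m 1 2 0 ≠ 0`. [OURS · idea-4's argument] [folklore] -/
theorem twoSlot_letterChange_freezes' {s t : ℕ → ℕ → ℕ → ℕ → K} {L : ℕ → Prop}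
    (hfix : ∀ m, L m → s m 1 2 0 ≠ 0 → s (m + 1) 1 2 0 ≠ 0)
    (hmuA : ∀ m, ¬ L m → s m 1 2 0 ≠ 0 → s (m + 1) 1 1 0 ≠ 0)
    (hmuB : ∀ m, ¬ L m → s m 1 3 0 ≠ 0 → s (m + 1) 1 2 0 ≠ 0)
    (hlegL : ∀ m, L m → s m 1 1 0 = 0)
    (hlegM : ∀ m, ¬ L m → s m 0 2 0 = 0 ∧ s m 1 1 0 = 0 ∧ s m 0 1 1 = 0 ∧ t m 0 1 0 = 0)
    (hflag : ∀ m, L m → s (m + 1) 0 2 0 ≠ 0 ∨ s (m + 1) 1 1 0 ≠ 0 ∨ s (m + 1) 0 1 1 ≠ 0 ∨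
      s (m + 1) 1 2 0 ≠ 0 ∨ s (m + 1) 1 3 0 ≠ 0 ∨ t (m + 1) 0 1 0 ≠ 0)
    {k : ℕ} (hk : L k) (hk1 : ¬ L (k + 1)) :
    ∀ m, k + 2 ≤ m → L m ∧ s m 1 2 0 ≠ 0 := by
  -- `x_λ x_μ ∈ S₀` is illegal for both letters
  have hkill : ∀ m, s m 1 1 0 ≠ 0 → False := fun m h => by
    by_cases hL : L m
    · exact h (hlegL m hL)
    · exact h (hlegM m hL).2.1
  -- a `μ`-step on `x_λ x_μ² ∈ S₀` is fatal one step later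
  have hstay : ∀ m, s m 1 2 0 ≠ 0 → L m := fun m h => by
    by_contra hL
    exact hkill (m + 1) (hmuA m hL h)
  -- the flag at `k + 1` leaves only `x_λ x_μ³`
  have h130 : s (k + 1) 1 3 0 ≠ 0 := by
    obtain ⟨h020, h110, h011, h010⟩ := hlegM (k + 1) hk1
    rcases hflag k hk with h | h | h | h | h | h
    · exact absurd h020 h
    · exact absurd h110 h
    · exact absurd h011 h
    · exact (hkill (k + 2) (hmuA (k + 1) hk1 h)).elim
    · exact h
    · exact absurd h010 h
  have h120 : s (k + 2) 1 2 0 ≠ 0 := hmuB (k + 1) hk1 h130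
  intro m hm
  induction m, hm using Nat.le_induction with
  | base => exact ⟨hstay _ h120, h120⟩
  | succ m hm ih =>
    have h' : s (m + 1) 1 2 0 ≠ 0 := hfix m ih.1 ih.2
    exact ⟨hstay _ h', h'⟩

/-- **THE SLOT IS EVENTUALLY CONSTANT** (implication form of `twoSlot_eventually_constant`): from some index on either every
step moves slot `λ` or every step moves slot `μ`. [OURS · idea-4's argument] [folklore] -/
theorem twoSlot_eventually_constant' {s t : ℕ → ℕ → ℕ → ℕ → K} {L : ℕ → Prop}
    (hfix : ∀ m, L m → s m 1 2 0 ≠ 0 → s (m + 1) 1 2 0 ≠ 0)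
    (hmuA : ∀ m, ¬ L m → s m 1 2 0 ≠ 0 → s (m + 1) 1 1 0 ≠ 0)
    (hmuB : ∀ m, ¬ L m → s m 1 3 0 ≠ 0 → s (m + 1) 1 2 0 ≠ 0)
    (hlegL : ∀ m, L m → s m 1 1 0 = 0)
    (hlegM : ∀ m, ¬ L m → s m 0 2 0 = 0 ∧ s m 1 1 0 = 0 ∧ s m 0 1 1 = 0 ∧ t m 0 1 0 = 0)
    (hflag : ∀ m, L m → s (m + 1) 0 2 0 ≠ 0 ∨ s (m + 1) 1 1 0 ≠ 0 ∨ s (m + 1) 0 1 1 ≠ 0 ∨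
      s (m + 1) 1 2 0 ≠ 0 ∨ s (m + 1) 1 3 0 ≠ 0 ∨ t (m + 1) 0 1 0 ≠ 0) :
    ∃ N, (∀ m, N ≤ m → L m) ∨ (∀ m, N ≤ m → ¬ L m) := by
  by_cases hchange : ∃ k, L k ∧ ¬ L (k + 1)
  · obtain ⟨k, hk, hk1⟩ := hchange
    exact ⟨k + 2, Or.inl fun m hm =>
      (twoSlot_letterChange_freezes' hfix hmuA hmuB hlegL hlegM hflag hk hk1 m hm).1⟩
  · push Not at hchange
    by_cases hsome : ∃ k, L k
    · obtain ⟨k, hk⟩ := hsome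
      refine ⟨k, Or.inl fun m hm => ?_⟩
      induction m, hm using Nat.le_induction with
      | base => exact hk
      | succ m _ ih => exact hchange m ih
    · push Not at hsome
      exact ⟨0, Or.inr fun m _ => hsome m⟩

/-! ## 2. A slot-constant tail is a free tail -/

section Free

variable (p : ℕ) [Fact p.Prime] [CharP K p] [DecidableEq K]

/-- **A TAIL OF SLOT-`A` STEPS IS A FREE TAIL** (cases S / F of idea-4's slot note): if after every slot-`A` step the slot is
carried by the chart letter just used, and a slot-`A` step charts the slot's letter or translates it away, then from a tail of
slot-`A` steps the free-tail theorem derives a non-isolated state. [OURS] [cite: CossartJannsenSaito2020, Thm. 3.14] -/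
theorem no_free_slot_tail {c : ℕ → State K} {j : ℕ → Fin 4} {b : ℕ → Fin 4 → K} (hc : ∀ k, IsIsolated p (c k).F)
    (hw : FreeTail.IsWitnessedChain p c j b) {k₁ : ℕ} {A : ℕ → Fin 4} {L : ℕ → Prop}
    (hA : ∀ m, L m → A (m + 1) = j (k₁ + m)) (hstep : ∀ m, L m → j (k₁ + m) = A m ∨ b (k₁ + m) (A m) ≠ 0)
    {N : ℕ} (hall : ∀ m, N ≤ m → L m) : False := by
  obtain ⟨k, hk⟩ := FreeTailProof.noIsolatedFreeTailAt_self p K c j b (k₁ + N) hw (fun n hn hsat => by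
    obtain ⟨m, rfl⟩ : ∃ m, n = k₁ + m := ⟨n - k₁, by omega⟩
    have hm : N ≤ m := by omega
    have hAm : A (m + 1) = j (k₁ + m) := hA m (hall m hm)
    rcases hstep (m + 1) (hall (m + 1) (by omega)) with h | h
    · exact hsat.1 (by rw [show k₁ + m + 1 = k₁ + (m + 1) by omega, h, hAm])
    · exact h (by rw [hAm, ← show k₁ + m + 1 = k₁ + (m + 1) by omega]; exact hsat.2))
  exact hk (hc k)

/-! ## 3. The skeleton with rotating letters -/

/-- **THE TWO-SLOT TAIL WITH ROTATING LETTERS, MODULO ITS READINGS** (K24a-R1 γ₀′).  Along an isolated witnessed chain, slot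
letters `A m`, `B m` (time `m` = chain time `k₁ + m`) with the bookkeeping of §2 for both slots (`L m` = slot-`A` step, else
slot-`B` step), and readings `s t` satisfying the implication-form instances of the two-slot game, do not exist: the game makes
one slot move for ever, and such a tail is free. [OURS] [cite: CossartJannsenSaito2020, Thm. 3.14, Thm. 9.3] -/
theorem no_twoSlot_tail_of_readings_free {c : ℕ → State K} {j : ℕ → Fin 4} {b : ℕ → Fin 4 → K}
    (hc : ∀ k, IsIsolated p (c k).F) (hw : FreeTail.IsWitnessedChain p c j b) {k₁ : ℕ} {A B : ℕ → Fin 4}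
    {L : ℕ → Prop} (hA : ∀ m, L m → A (m + 1) = j (k₁ + m))
    (hstepA : ∀ m, L m → j (k₁ + m) = A m ∨ b (k₁ + m) (A m) ≠ 0)
    (hB : ∀ m, ¬ L m → B (m + 1) = j (k₁ + m))
    (hstepB : ∀ m, ¬ L m → j (k₁ + m) = B m ∨ b (k₁ + m) (B m) ≠ 0) {s t : ℕ → ℕ → ℕ → ℕ → K}
    (hfix : ∀ m, L m → s m 1 2 0 ≠ 0 → s (m + 1) 1 2 0 ≠ 0)
    (hmuA : ∀ m, ¬ L m → s m 1 2 0 ≠ 0 → s (m + 1) 1 1 0 ≠ 0)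
    (hmuB : ∀ m, ¬ L m → s m 1 3 0 ≠ 0 → s (m + 1) 1 2 0 ≠ 0)
    (hlegL : ∀ m, L m → s m 1 1 0 = 0)
    (hlegM : ∀ m, ¬ L m → s m 0 2 0 = 0 ∧ s m 1 1 0 = 0 ∧ s m 0 1 1 = 0 ∧ t m 0 1 0 = 0)
    (hflag : ∀ m, L m → s (m + 1) 0 2 0 ≠ 0 ∨ s (m + 1) 1 1 0 ≠ 0 ∨ s (m + 1) 0 1 1 ≠ 0 ∨
      s (m + 1) 1 2 0 ≠ 0 ∨ s (m + 1) 1 3 0 ≠ 0 ∨ t (m + 1) 0 1 0 ≠ 0) : False := by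
  obtain ⟨N, hN⟩ := twoSlot_eventually_constant' hfix hmuA hmuB hlegL hlegM hflag
  rcases hN with hL | hM
  · exact no_free_slot_tail p hc hw hA hstepA hL
  · exact no_free_slot_tail p hc hw (L := fun m => ¬ L m) hB hstepB hM

end Free

end ResCone

end Summit.ResolutionOfSingularities.ResolutionOfSingularities.Theorems.PIDim4
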